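import Literature.MathematicalPhysics.QuantumFieldTheory.Balaban1983to89.B15Prop1LinearisedDatumCoordinatesTower
import Literature.MathematicalPhysics.QuantumFieldTheory.Balaban1983to89.B15Prop1DatumCoordinatesTowerB

/-!
# `Balaban1983to89.B15Prop1LinearisedDatumCoordinatesTower` — [Balaban1985Variational] = «[15]», Sect. C (45)–(48) p. 285, (82)–(83) p. 290, Sect. G p. 305; [Balaban1988Convergent] (2.10)–(2.11) — **BOND-DATUM EDITION** (`…B15Prop1LinearisedDatumCoordinatesTowerB`): the print-datum ([Balaban1984PropagatorsII] (2.3)) twin of `B15Prop1LinearisedDatumCoordinatesTower` — class (γ) of dag-n12-c's census-by-declaration v2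
(bus [DAGN12C-G35], 2026-08-30): the parent reads its determining set `𝐁 : DetSet` only through `AgreeOn 𝐁 ∕ IsMinimizer … 𝐁 ∕ n07-w2's index `constrCard ∕ constrEnum 𝐁 k` ∕ `msChart``,
so the twin is a GENERATOR file (HOME `lean/g35/gen/gen_whole.py`): namespace `…B`, SAME declaration names, `DetSet ↦ BDetSet` (F0a), `AgreeOn ↦ AgreeOnB`, `IsMinimizer ↦ IsMinimizerB`,
`bondsOf (𝐁 j) ↦ 𝔅 j`, `constrCard ∕ constrEnum ∕ ConstrSet ∕ msChart ↦ …B` (lane `Node00/MultiScaleFibreChartB`), `IsCritOnFibre ∕ IsFibreChartNear ↦ …B`; proofs VERBATIM; the parent's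
datum-free declarations are re-elaborated under the same names in the `…B` namespace (harmless duplicates) or reused via `open`.  The (b) statements are the instances `𝔅 := bondsDet 𝐁` (`Iff.rfl`).

statement-level skeleton of published theorems with citation tags; proofs where landed; nothing here is a claim about
the Yang–Mills mass gap

Cell `pub-ymgap` (HUMAN RULINGS D-0062 ∕ D-0149), lane `pub-ymgap-dag-n12-c` g35 (R134 seat (a), N12 = [B15], s1, lane owner); `--kind proof --supports` K1⁹ `stmt-QuantumFields-27364`; count-neutral.
THEOREMS ONLY unless the parent has `def`s (then `--kind definition`).  HONESTY GUARD (director-ym №338 (5)): PURELY ADDITIVE — the parent stays landed and true on its own text; nothing in it is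
edited; no displayed premise of any consumer is deleted or weakened; every hypothesis of the parent stays a hypothesis.  Nothing of Bałaban's analysis asserted; count-neutral; N12 NOT discharged; K0⁷ ∕
K1⁹ NOT closed; one finite 𝕋⁴ programme at fixed ε — nothing continuum ∕ ℝ⁴ ∕ OS; the Yang–Mills mass gap (Clay) is NOT proved by any of this.

PARENT's DOCSTRING (for the mathematics and the citations; read `𝐁` as the bond datum `𝔅`):
# `Balaban1983to89.B15Prop1LinearisedDatumCoordinatesTower` — [Balaban1985Variational] = «[15]», Sect. C (45)–(48) p. 285, (82)–(83) p. 290, Sect. G p. 305; [Balaban1988Convergent] (2.10)–(2.11)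
# p. 256; [Balaban1985Averaging] (21) p. 21:  THE LINEARISED DATUM COORDINATES ALONG A CHART LINE UNDER THE PER-TOWER (0.4) GUARDS — the «TP» twin of §2 of
# `B15Prop1LinearisedDatumCoordinates` (LOCATED-E1-HSB repair step (r3), link 3∕9)

Honest framing: statement-level skeleton of published theorems with citation tags; proofs where landed; nothing here is a claim about the
Yang–Mills mass gap.  Cell `pub-ymgap`, HUMAN RULING D-0062 (Track A), seat `pub-ymgap-dag-n12-c` g24 (lane owner N12 = [B15], strategy s1; lane memo `N12-UNIFORMITY-SPEC.md` §6,
plan g91 word pub-ymgap INBOX l.45435 «(r3) = ADDITIVE TP-twins»); count-neutral; N12 NOT discharged; finite 𝕋⁴ at fixed ε; nothing continuum ∕ OS ∕ mass-gap ∕ Clay.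

WHAT CHANGES AGAINST THE TWIN (dag-n12-w1 g2's `B15Prop1LinearisedDatumCoordinates`, untouched).  §2's three theorems (`eventually_datumCoord_chart_eq_model`,
★★ `fderiv_datumCoord_expMulC_apply_of_hasDerivAt` — `DΦ₀(0)(cplxVec p)_i = T (W_j(c)⋆ · v)` from the VELOCITY letter `hv` —, `fderiv_datumCoord_expMulC_apply_coord`) are re-proved VERBATIM with
the global guard `hsb : SmallBelow k U₀` replaced by the ENUMERATED per-tower guards `hg` at the constrained bonds of `𝔹` (+ the standing range `hk : k ≤ m + K`): the guard along the chart
line comes from `B15Prop1DatumCoordinatesTower.eventually_guardOn_constr`, the identification `W⋆ · iterMh = W⋆ · ↑Ū` from `star_coe_mul_iterMh_coeField_of_guardOn`, the analyticity of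
`κ` from `eventually_analyticAt_datumCoord_of_guardOn`.  §1 of the twin (`exists_logCoordCLM`, `hasFDerivAt_logCoordC_one`) and the chart-line lemmas are reused by name.

CONTENTS (theorems only; no `def`, no `instance`, no `sorry`).  `eventually_datumCoord_chart_eq_model_of_guardOn` · ★★ `fderiv_datumCoord_expMulC_apply_of_hasDerivAt_of_guardOn` ·
`fderiv_datumCoord_expMulC_apply_coord_of_guardOn`.
-/


noncomputable section

namespace Literature.MathematicalPhysics.QuantumFieldTheory.Balaban1983to89.B15Prop1LinearisedDatumCoordinatesTowerB
open B15Prop1DatumCoordinatesTowerB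

open B15Prop1LinearisedDatumCoordinatesTower

open Set Filter
open scoped Topology ContDiff ComplexConjugate
open Literature.Analysis.Calculus.LagrangeHessianRealCoercive (hasDerivAt_comp_realLine)
open Literature.MathematicalPhysics.QuantumFieldTheory.Balaban1983to89.Node00 (SU coeField coeField_apply SmallBelow ConstrSetB constrCardB constrEnumB star_coe_mul_coe_SU)
open B15AveragingHolomorphic (iterMh coeField_iter_eq_iterMh)
open B15SU2ChartHolomorphic (genE expMulC logCoordC logCoordC_apply)
open B15Prop1StateChartSU2 (analyticAt_expMulC_right expMulC_cplxVec_coeField_eq)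
open B15Prop1DatumCoordinates (expMulC_zero_left)
open B15Prop1DatumCoordinatesTower (eventually_guardOn_constr eventually_analyticAt_datumCoord_of_guardOn star_coe_mul_iterMh_coeField_of_guardOn)
open B15Prop1LinearisedDatumCoordinates (exists_logCoordCLM hasFDerivAt_logCoordC_one coeField_expMul_smul tendsto_coeField_expMul_smul)
open B15Prop1HessianNondegenerateOfRealCoercive (cplxVec_smul)
open B15Prop1AnalyticExtClause (cplxVec)
open B15Prop1ChartCalculusSU2 (E3)
open B15Prop1ChartSU2 (su2Chart)
open B16Sect1Backgrounds (expMul expMul_zero)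
open MatrixLog (mlog)
open ExpMeanLog (expMeanLogSU)
open BlockAveraging (blockAvg)
open T4CubeChartGnomonic (SU2)
open T4Continuum B15DeterminingSets B15DeterminingSetsB GaugeField
open scoped Matrix.Norms.L2Operator

/-! ## §2  The linearised datum coordinates along a real chart line, under the tower guards -/

section Linearised

variable {P : Params}

variable (𝔅 : BDetSet P) (k : ℕ) (hk : k ≤ P.m + P.K) (W : MSField P SU2)
  (κ : (PBond P 0 → Matrix (Fin 2) (Fin 2) ℂ) → Fin (constrCardB 𝔅 k) → EuclideanSpace ℂ (Fin 3))
  (hκ : ∀ Q i, κ Q i = logCoordC (star ((W ((constrEnumB 𝔅 k).symm i).1 ((constrEnumB 𝔅 k).symm i).2.1 : SU2) : Matrix (Fin 2) (Fin 2) ℂ) *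
    iterMh ((constrEnumB 𝔅 k).symm i).1 Q ((constrEnumB 𝔅 k).symm i).2.1))
include hk hκ

/-- **NEAR `s = 0` THE COMPLEX COORDINATE CURVE ALONG THE CHART LINE IS THE LOGARITHMIC COORDINATE OF THE REAL RELATIVE AVERAGE** (the chart configuration stays guarded; there the
holomorphic iterate is the averaging of record). [cite: Balaban1988Convergent, (2.10)–(2.11) p.256; Balaban1987RG1, (0.4) p.253] -/
theorem eventually_datumCoord_chart_eq_model_of_guardOn {U₀ : GaugeField P 0 SU2}
    (hg : ∀ i : Fin (constrCardB 𝔅 k), ∀ j', j' < (((constrEnumB 𝔅 k).symm i).1 : ℕ) → ∀ c' : PBond P (j' + 1),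
      c' ∈ B10Eq42TorusConstraint.bondsIn (j' + 1) (B14.Eq22Determines.blockIter (((constrEnumB 𝔅 k).symm i).1 : ℕ) ⁻¹'
        ({((constrEnumB 𝔅 k).symm i).2.1.src, ((constrEnumB 𝔅 k).symm i).2.1.tgt} : Set (Site P ((constrEnumB 𝔅 k).symm i).1))) →
        BlockAveraging.Small expMeanLogSU (Averaging.iter (fun j => blockAvg (P := P) (j := j) expMeanLogSU) j' U₀) c')
    (p : VecField P 0 E3) (i : Fin (constrCardB 𝔅 k)) :
    ∀ᶠ s : ℝ in 𝓝 0, κ (expMulC ((0 : VecField P 0 (EuclideanSpace ℂ (Fin 3))) + (s : ℂ) • cplxVec p) (coeField U₀)) i =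
      logCoordC (star ((W ((constrEnumB 𝔅 k).symm i).1 ((constrEnumB 𝔅 k).symm i).2.1 : SU2) : Matrix (Fin 2) (Fin 2) ℂ) *
        ((avgFamily (fun j => blockAvg (P := P) (j := j) expMeanLogSU) (expMul su2Chart (s • p) U₀) ((constrEnumB 𝔅 k).symm i).1
          ((constrEnumB 𝔅 k).symm i).2.1 : SU2) : Matrix (Fin 2) (Fin 2) ℂ)) := by
  filter_upwards [(tendsto_coeField_expMul_smul U₀ p).eventually (eventually_guardOn_constr 𝔅 k hk hg)] with s hs
  have hguard := hs (expMul su2Chart (s • p) U₀) rfl i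
  rw [← coeField_expMul_smul, hκ, star_coe_mul_iterMh_coeField_of_guardOn W ((Nat.lt_succ_iff.1 ((constrEnumB 𝔅 k).symm i).1.2).trans hk) _ hguard]

/-- ★★ **THE LINEARISED DATUM COORDINATES ALONG A CHART LINE.**  At a base configuration `U₀` on the fibre of `W` (guarded below `k`), for a real direction `p` and a constrained bond
`(j,c)` with VELOCITY `v = d/ds|₀ ↑Ū^j(exp(s p)·U₀)(c)` (hypothesis `hv`, the currency of n07-w2's right-inverse letter), the derivative of the complex constraint coordinates
`Φ₀ X = κ (expMulC X ↑U₀)` at `0` in the direction `cplxVec p` has `i`-th component `T (W_j(c)⋆ · v)`, `T` the linear part of the logarithmic coordinates.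
[cite: Balaban1985Variational, Sect. C (45)–(48) p.285, (82)–(83) p.290; Balaban1988Convergent, (2.10)–(2.11) p.256; Balaban1985Averaging, (21) p.21] -/
theorem fderiv_datumCoord_expMulC_apply_of_hasDerivAt_of_guardOn {U₀ : GaugeField P 0 SU2}
    (hg : ∀ i : Fin (constrCardB 𝔅 k), ∀ j', j' < (((constrEnumB 𝔅 k).symm i).1 : ℕ) → ∀ c' : PBond P (j' + 1),
      c' ∈ B10Eq42TorusConstraint.bondsIn (j' + 1) (B14.Eq22Determines.blockIter (((constrEnumB 𝔅 k).symm i).1 : ℕ) ⁻¹'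
        ({((constrEnumB 𝔅 k).symm i).2.1.src, ((constrEnumB 𝔅 k).symm i).2.1.tgt} : Set (Site P ((constrEnumB 𝔅 k).symm i).1))) →
        BlockAveraging.Small expMeanLogSU (Averaging.iter (fun j => blockAvg (P := P) (j := j) expMeanLogSU) j' U₀) c')
    (hU : AgreeOnB 𝔅 (avgFamily (fun j => blockAvg (P := P) (j := j) expMeanLogSU) U₀) W)
    {T : Matrix (Fin 2) (Fin 2) ℂ →L[ℂ] EuclideanSpace ℂ (Fin 3)} (hT : ∀ M a, T M a = -(1 / 2 : ℂ) * (genE a * M).trace)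
    (p : VecField P 0 E3) (i : Fin (constrCardB 𝔅 k)) {v : Matrix (Fin 2) (Fin 2) ℂ}
    (hv : HasDerivAt (fun s : ℝ => ((avgFamily (fun j => blockAvg (P := P) (j := j) expMeanLogSU) (expMul su2Chart (s • p) U₀) ((constrEnumB 𝔅 k).symm i).1
      ((constrEnumB 𝔅 k).symm i).2.1 : SU2) : Matrix (Fin 2) (Fin 2) ℂ)) v 0) :
    fderiv ℂ (fun X : VecField P 0 (EuclideanSpace ℂ (Fin 3)) => κ (expMulC X (coeField U₀))) 0 (cplxVec p) i =
      T (star ((W ((constrEnumB 𝔅 k).symm i).1 ((constrEnumB 𝔅 k).symm i).2.1 : SU2) : Matrix (Fin 2) (Fin 2) ℂ) * v) := by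
  set s₀ := (constrEnumB 𝔅 k).symm i with hs₀
  set Ws : Matrix (Fin 2) (Fin 2) ℂ := star ((W s₀.1 s₀.2.1 : SU2) : Matrix (Fin 2) (Fin 2) ℂ) with hWs
  -- `Φ₀` is analytic at `0` (`κ` analytic near `↑U₀`, the chart analytic with `expMulC 0 ↑U₀ = ↑U₀`)
  have hκan : AnalyticAt ℂ κ (coeField U₀) := (eventually_analyticAt_datumCoord_of_guardOn 𝔅 k hk W κ hκ hg hU).self_of_nhds
  have hΦ : DifferentiableAt ℂ (fun X : VecField P 0 (EuclideanSpace ℂ (Fin 3)) => κ (expMulC X (coeField U₀))) 0 := by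
    have h1 : AnalyticAt ℂ κ (expMulC (0 : VecField P 0 (EuclideanSpace ℂ (Fin 3))) (coeField U₀)) := by rw [expMulC_zero_left]; exact hκan
    exact (AnalyticAt.comp (f := fun X : VecField P 0 (EuclideanSpace ℂ (Fin 3)) => expMulC X (coeField U₀)) (x := 0) h1
      (analyticAt_expMulC_right (coeField U₀) 0)).differentiableAt
  -- the derivative along the ray, component `i`
  have hray := hasDerivAt_comp_realLine (x₀ := (0 : VecField P 0 (EuclideanSpace ℂ (Fin 3)))) (cplxVec p) hΦ
  have hrayi : HasDerivAt (fun t : ℝ => κ (expMulC ((0 : VecField P 0 (EuclideanSpace ℂ (Fin 3))) + (t : ℂ) • cplxVec p) (coeField U₀)) i)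
      (fderiv ℂ (fun X : VecField P 0 (EuclideanSpace ℂ (Fin 3)) => κ (expMulC X (coeField U₀))) 0 (cplxVec p) i) 0 :=
    (hasDerivAt_pi.1 hray) i
  -- the model curve `t ↦ logCoordC (W⋆ · ↑Ū(exp(t p)·U₀))` and its derivative
  have hm : HasDerivAt (fun t : ℝ => Ws * ((avgFamily (fun j => blockAvg (P := P) (j := j) expMeanLogSU) (expMul su2Chart (t • p) U₀) s₀.1 s₀.2.1 : SU2) :
      Matrix (Fin 2) (Fin 2) ℂ)) (Ws * v) 0 := hv.const_mul Ws
  have hm0 : Ws * ((avgFamily (fun j => blockAvg (P := P) (j := j) expMeanLogSU) (expMul su2Chart ((0 : ℝ) • p) U₀) s₀.1 s₀.2.1 : SU2) :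
      Matrix (Fin 2) (Fin 2) ℂ) = 1 := by
    rw [zero_smul, expMul_zero, hU _ _ s₀.2.2, hWs, star_coe_mul_coe_SU]
  have hlog : HasDerivAt (fun t : ℝ => logCoordC (Ws * ((avgFamily (fun j => blockAvg (P := P) (j := j) expMeanLogSU) (expMul su2Chart (t • p) U₀) s₀.1 s₀.2.1 :
      SU2) : Matrix (Fin 2) (Fin 2) ℂ))) (T (Ws * v)) 0 := by
    have hD : HasFDerivAt logCoordC (T.restrictScalars ℝ)
        (Ws * ((avgFamily (fun j => blockAvg (P := P) (j := j) expMeanLogSU) (expMul su2Chart ((0 : ℝ) • p) U₀) s₀.1 s₀.2.1 : SU2) : Matrix (Fin 2) (Fin 2) ℂ)) := by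
      rw [hm0]; exact (hasFDerivAt_logCoordC_one hT).restrictScalars ℝ
    have h := hD.comp_hasDerivAt (0 : ℝ) hm
    exact h
  -- the true component curve equals the model near `0`
  have heq : (fun t : ℝ => κ (expMulC ((0 : VecField P 0 (EuclideanSpace ℂ (Fin 3))) + (t : ℂ) • cplxVec p) (coeField U₀)) i) =ᶠ[𝓝 0]
      fun t : ℝ => logCoordC (Ws * ((avgFamily (fun j => blockAvg (P := P) (j := j) expMeanLogSU) (expMul su2Chart (t • p) U₀) s₀.1 s₀.2.1 : SU2) :
        Matrix (Fin 2) (Fin 2) ℂ)) :=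
    eventually_datumCoord_chart_eq_model_of_guardOn 𝔅 k hk W κ hκ hg p i
  exact hrayi.unique (hlog.congr_of_eventuallyEq heq)

/-- The coordinate form: `(DΦ₀(0)(cplxVec p))_{i,a} = −½ tr(E_a · W_j(c)⋆ · v)`. [cite: Balaban1985Variational, Sect. C (47)–(48) p.285; Balaban1985Averaging, (21) p.21] -/
theorem fderiv_datumCoord_expMulC_apply_coord_of_guardOn {U₀ : GaugeField P 0 SU2}
    (hg : ∀ i : Fin (constrCardB 𝔅 k), ∀ j', j' < (((constrEnumB 𝔅 k).symm i).1 : ℕ) → ∀ c' : PBond P (j' + 1),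
      c' ∈ B10Eq42TorusConstraint.bondsIn (j' + 1) (B14.Eq22Determines.blockIter (((constrEnumB 𝔅 k).symm i).1 : ℕ) ⁻¹'
        ({((constrEnumB 𝔅 k).symm i).2.1.src, ((constrEnumB 𝔅 k).symm i).2.1.tgt} : Set (Site P ((constrEnumB 𝔅 k).symm i).1))) →
        BlockAveraging.Small expMeanLogSU (Averaging.iter (fun j => blockAvg (P := P) (j := j) expMeanLogSU) j' U₀) c')
    (hU : AgreeOnB 𝔅 (avgFamily (fun j => blockAvg (P := P) (j := j) expMeanLogSU) U₀) W)
    (p : VecField P 0 E3) (i : Fin (constrCardB 𝔅 k)) {v : Matrix (Fin 2) (Fin 2) ℂ}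
    (hv : HasDerivAt (fun s : ℝ => ((avgFamily (fun j => blockAvg (P := P) (j := j) expMeanLogSU) (expMul su2Chart (s • p) U₀) ((constrEnumB 𝔅 k).symm i).1
      ((constrEnumB 𝔅 k).symm i).2.1 : SU2) : Matrix (Fin 2) (Fin 2) ℂ)) v 0) (a : Fin 3) :
    fderiv ℂ (fun X : VecField P 0 (EuclideanSpace ℂ (Fin 3)) => κ (expMulC X (coeField U₀))) 0 (cplxVec p) i a =
      -(1 / 2 : ℂ) * (genE a * (star ((W ((constrEnumB 𝔅 k).symm i).1 ((constrEnumB 𝔅 k).symm i).2.1 : SU2) : Matrix (Fin 2) (Fin 2) ℂ) * v)).trace := by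
  obtain ⟨T, hT⟩ := exists_logCoordCLM
  rw [fderiv_datumCoord_expMulC_apply_of_hasDerivAt_of_guardOn 𝔅 k hk W κ hκ hg hU hT p i hv, hT]

end Linearised

end Literature.MathematicalPhysics.QuantumFieldTheory.Balaban1983to89.B15Prop1LinearisedDatumCoordinatesTowerB

end
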